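import Mathlib.Algebra.BigOperators.Fin
import Summits.MatrixMultiplication.MatrixMultiplication.Theorems.SaturationLadderLinearRestriction
import Summits.MatrixMultiplication.MatrixMultiplication.Theorems.SaturationLadderTwinComponents
import Summits.MatrixMultiplication.MatrixMultiplication.Theorems.ShapeSubmodularityPerfectAmortisationStubCwRectRestriction
import Literature.Computability.AlgebraicComplexity.AsymptoticRankMultiplesMatMul
import Literature.Barriers.MatrixMultiplication.UniversalMethodBarrierAsymptoticRank
import Literature.Barriers.MatrixMultiplication.UniversalMethodBarrier
import HarnessLib

/-!
# SaturationLadder — twin rectangular restriction (tensor layer of the twin rung)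

Route `SaturationLadder` (sub-problem `MatrixMultiplication`), support for the aside
`TwinSaturation` (stmt-MatrixMultiplication-30539); third of three files.  Block supports of the
component matrices `twMI/twMJ/twML` of the twin tensor `TW_b`
(`Theorems/SaturationLadderTwinComponents.lean`), the block formats along a label word
(`∏_ρ twFmtK = b^{m₁}`, `∏_ρ twFmtM = (2b)^{m₂} 2^{m₁} 2^{m₄}`, `∏_ρ twFmtN = (2b)^{m₃} 2^{m₅}`,
`mᵢ` the letter counts of `(1,1,0), (0,1,1), (1,0,1), (0,2,0), (2,0,0)`), and the twin analogue
`twRectRestriction` of the tree's `stub_cwRectRestriction`: for a free diagonal `Δ` of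
`cwSupport₃^N`-supported level triples with these letter counts,
`TW_b^{⊗N} ≥ ⟨|Δ|⟩ ⊗ ⟨b^{m₁}, (2b)^{m₂} 2^{m₁} 2^{m₄}, (2b)^{m₃} 2^{m₅}⟩`, by the linear form of
BCS Prop. 15.30 (`Theorems/SaturationLadderLinearRestriction.lean`) and regrouping of equal
blocks (`PerfectAmortisation.tensorRestrictsTo_matMulDirectSum_multiple_of_eq`).  With
`R̃(TW_b) ≤ 2b+3` (`Theorems/SaturationLadderTwinCW.lean`), `R̃(s) ≤ R̃(t)` for `t ≥ s`, `R̃(t^{⊗N}) ≤ R̃(t)^N`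
and the asymptotic sum inequality `|Δ| · 2^{ω(a,b,c)} ≤ R̃(⟨|Δ|⟩ ⊗ ⟨2^a, 2^b, 2^c⟩)` (ADVXXZ 2025,
Thm. 3.2) this gives, for `b = 2^j`, the EXPONENT INEQUALITY of the twin laser method
(`twChain`): `|Δ| · 2^{ω(j m₁, (j+1) m₂ + m₁ + m₄, (j+1) m₃ + m₅)} ≤ (2^{j+1} + 3)^N`, and its solved
form `omegaRect_tw_le_of_card`: a free diagonal with `(2^{j+1}+3)^N ≤ |Δ| · 2^e` certifies
`ω(j m₁, (j+1) m₂ + m₁ + m₄, (j+1) m₃ + m₅) ≤ e`.  What remains for the rung `TwinSaturation` recorded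
on the item is the combinatorial layer only (free diagonals of the twin-optimal joint types and their
entropy count, as in `Theorems/SaturationLadderExpSaturationDiagonal.lean` for `CW_q`).

References: Bürgisser–Clausen–Shokrollahi (1997) §15.6 Prop. 15.30, §15.7 Thm. 15.41
[BurgisserClausenShokrollahi1997]; Coppersmith–Winograd (1990) §6–8 [CoppersmithWinograd1990];
Alman–Duan–Vassilevska Williams–Xu–Xu–Zhou, SODA 2025, Thm. 3.2
[AlmanDuanVassilevskaWilliamsXuXuZhou2025]; Christandl–Vrana–Zuiddam 2023 §1.1 (`R̃(t^{⊗k}) ≤ R̃(t)^k`)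
[ChristandlVranaZuiddam2023].
-/

noncomputable section

open scoped BigOperators
open Finset Literature.Computability.AlgebraicComplexity

namespace Summit.MatrixMultiplication.MatrixMultiplication.Theorems.SaturationLadderTwinRestriction

open Summit.MatrixMultiplication.MatrixMultiplication.Theorems.SaturationLadderLinearRestriction
open Summit.MatrixMultiplication.MatrixMultiplication.Theorems.SaturationLadderTwinComponents

universe u

variable {K : Type u} [CommSemiring K]

section TwinData

open Summit.MatrixMultiplication.MatrixMultiplication.Theorems.SaturationLadderTwinCW
open Summit.MatrixMultiplication.MatrixMultiplication.Theorems.SaturationLadderTwinCW.TwIdx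

variable {b : ℕ}

/-- `fstOf d` has level `1` for `d < b`. [folklore] -/
theorem levX_fstOf {d : ℕ} (h : d < b) : levX b (fstOf b d) = 1 := by simp [fstOf, h, levX]

/-- `sndOf d` has level `1` for `d < b`. [folklore] -/
theorem levX_sndOf {d : ℕ} (h : d < b) : levX b (sndOf b d) = 1 := by simp [sndOf, h, levX]

/-- `linOf d` has level `1` for `d < 2b`. [folklore] -/
theorem levX_linOf {d : ℕ} (h : d < b + b) : levX b (linOf b d) = 1 := by
  by_cases h1 : d < b
  · simp [linOf, h1, levX]
  · have h2 : d - b < b := by omega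
    simp [linOf, h1, h2, levX]

/-- `linOf d` has `z`-level `1` for `d < 2b`. [folklore] -/
theorem levZ_linOf {d : ℕ} (h : d < b + b) : levZ b (linOf b d) = 1 := by
  by_cases h1 : d < b
  · simp [linOf, h1, levZ]
  · have h2 : d - b < b := by omega
    simp [linOf, h1, h2, levZ]

/-- `socOf d` has level `2`. [folklore] -/
theorem levX_socOf (d : ℕ) : levX b (socOf b d) = 2 := by
  by_cases h : d = 0 <;> simp [socOf, h, levX]

/-- `socOf d` has `z`-level `0`. [folklore] -/
theorem levZ_socOf (d : ℕ) : levZ b (socOf b d) = 0 := by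
  by_cases h : d = 0 <;> simp [socOf, h, levZ]

/-- The `x`-matrix of a component is supported in its `x`-block. [folklore] -/
theorem levX_of_twMI_ne_zero (s : Fin 3 × Fin 3 × Fin 3) (hs : s ∈ cwSupport₃)
    (u : Fin (twFmtK b s) × Fin (twFmtN b s)) (a : TwIdx b) (h : twMI K b s u a ≠ 0) :
    levX b a = s.1 := by
  have hu1 := u.1.isLt; have hu2 := u.2.isLt
  by_cases h1 : a = twXIdx b s u.1 u.2
  · rw [h1]
    rw [mem_cwSupport₃_iff] at hs
    rcases hs with rfl | rfl | rfl | rfl | rfl | rfl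
    · simp [twXIdx, levX]
    · simp only [twFmtK, twFmtN] at hu1 hu2; norm_num at hu1 hu2
      simp only [twXIdx]; norm_num
      exact levX_linOf (by omega)
    · simp only [twFmtK, twFmtN] at hu1 hu2; norm_num at hu1 hu2
      simp only [twXIdx]; norm_num
      exact levX_fstOf (by omega)
    · simp only [twXIdx]; norm_num
      exact levX_socOf _
    · simp [twXIdx, levX]
    · simp [twXIdx, levX]
  · by_cases h2 : s = (1, 1, 0)
    · subst h2
      by_cases h3 : a = twXIdx' b u.1 u.2
      · rw [h3]
        have e1 : twFmtK b (1, 1, 0) = b := by simp [twFmtK]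
        have e2 : twFmtN b (1, 1, 0) = 1 := by simp [twFmtN]
        have hu1' : (u.1 : ℕ) < b := lt_of_lt_of_eq u.1.isLt e1
        have hu2' : (u.2 : ℕ) < 1 := lt_of_lt_of_eq u.2.isLt e2
        simp only [twXIdx']
        exact levX_sndOf (by omega)
      · exfalso; apply h
        simp only [twMI]
        rw [if_neg h1, if_neg h3]
        simp
    · exfalso; apply h
      simp only [twMI]
      rw [if_neg h1, if_neg h2, add_zero]

/-- The `y`-matrix of a component is supported in its `y`-block. [folklore] -/
theorem levX_of_twMJ_ne_zero (s : Fin 3 × Fin 3 × Fin 3) (hs : s ∈ cwSupport₃)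
    (v : Fin (twFmtK b s) × Fin (twFmtM b s)) (c : TwIdx b) (h : twMJ K b s v c ≠ 0) :
    levX b c = s.2.1 := by
  have hv1 := v.1.isLt; have hv2 := v.2.isLt
  by_cases h1 : c = twYIdx b s v.1 v.2
  · rw [h1]
    rw [mem_cwSupport₃_iff] at hs
    rcases hs with rfl | rfl | rfl | rfl | rfl | rfl
    · simp only [twFmtK, twFmtM] at hv1 hv2; norm_num at hv1 hv2
      simp only [twYIdx]; norm_num
      exact levX_linOf (by omega)
    · simp [twYIdx, levX]
    · simp only [twFmtK, twFmtM] at hv1 hv2; norm_num at hv1 hv2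
      simp only [twYIdx]; norm_num
      by_cases h0 : (v.2 : ℕ) = 0
      · rw [if_pos h0]; exact levX_fstOf (by omega)
      · rw [if_neg h0]; exact levX_sndOf (by omega)
    · simp [twYIdx, levX]
    · simp only [twYIdx]; norm_num
      exact levX_socOf _
    · simp [twYIdx, levX]
  · exfalso; apply h
    simp only [twMJ]
    rw [if_neg h1]

/-- The `z`-matrix of a component is supported in its `z`-block. [folklore] -/
theorem levZ_of_twML_ne_zero (s : Fin 3 × Fin 3 × Fin 3) (hs : s ∈ cwSupport₃)
    (w : Fin (twFmtM b s) × Fin (twFmtN b s)) (c : TwIdx b) (h : twML K b s w c ≠ 0) :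
    levZ b c = s.2.2 := by
  have hw1 := w.1.isLt; have hw2 := w.2.isLt
  by_cases h1 : c = twZIdx b s w.1 w.2
  · rw [h1]
    rw [mem_cwSupport₃_iff] at hs
    rcases hs with rfl | rfl | rfl | rfl | rfl | rfl
    · simp only [twFmtM, twFmtN] at hw1 hw2; norm_num at hw1 hw2
      simp only [twZIdx]; norm_num
      exact levZ_linOf (by omega)
    · simp only [twFmtM, twFmtN] at hw1 hw2; norm_num at hw1 hw2
      simp only [twZIdx]; norm_num
      exact levZ_linOf (by omega)
    · simp only [twZIdx]; norm_num
      exact levZ_socOf _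
    · simp only [twZIdx]; norm_num
      exact levZ_socOf _
    · simp only [twZIdx]; norm_num
      exact levZ_socOf _
    · simp [twZIdx, levZ]
  · exfalso; apply h
    simp only [twML]
    rw [if_neg h1]

/-! ### The block formats along a label word -/

/-- `∏_ρ (if w_ρ = s₀ then B else 1) = B ^ #{ρ | w_ρ = s₀}`. [folklore] -/
theorem prod_ite_eq_pow {N : ℕ} (w : Fin N → Fin 3 × Fin 3 × Fin 3) (s₀ : Fin 3 × Fin 3 × Fin 3)
    (B : ℕ) : ∏ ρ, (if w ρ = s₀ then B else 1) = B ^ letterCount w s₀ := by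
  classical
  rw [prod_apply_eq_prod_pow_letterCount (fun s => if s = s₀ then B else 1) w,
    Finset.prod_eq_single s₀]
  · simp
  · intro s _ hs
    simp [hs]
  · simp

/-- `∏_ρ twFmtK b (w_ρ) = b ^ m₁₁₀`. [folklore] -/
theorem prod_twFmtK_eq {N : ℕ} (w : Fin N → Fin 3 × Fin 3 × Fin 3) :
    ∏ ρ, twFmtK b (w ρ) = b ^ letterCount w (1, 1, 0) :=
  prod_ite_eq_pow w _ b

/-- `∏_ρ twFmtM b (w_ρ) = (2b) ^ m₀₁₁ · 2 ^ m₁₁₀ · 2 ^ m₀₂₀`. [folklore] -/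
theorem prod_twFmtM_eq {N : ℕ} (w : Fin N → Fin 3 × Fin 3 × Fin 3) :
    ∏ ρ, twFmtM b (w ρ) =
      (b + b) ^ letterCount w (0, 1, 1) * 2 ^ letterCount w (1, 1, 0) * 2 ^ letterCount w (0, 2, 0) := by
  simp only [twFmtM, Finset.prod_mul_distrib, prod_ite_eq_pow]

/-- `∏_ρ twFmtN b (w_ρ) = (2b) ^ m₁₀₁ · 2 ^ m₂₀₀`. [folklore] -/
theorem prod_twFmtN_eq {N : ℕ} (w : Fin N → Fin 3 × Fin 3 × Fin 3) :
    ∏ ρ, twFmtN b (w ρ) = (b + b) ^ letterCount w (1, 0, 1) * 2 ^ letterCount w (2, 0, 0) := by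
  simp only [twFmtN, Finset.prod_mul_distrib, prod_ite_eq_pow]

/-! ### The twin rectangular restriction -/

open Summit.MatrixMultiplication.MatrixMultiplication.Theorems.PerfectAmortisation
  (tensorRestrictsTo_matMulDirectSum_multiple_of_eq)

/-- **Twin rectangular restriction (tensor layer of the twin rung).**  For level triples `Δ` of
`TW_b^{⊗N}` supported coordinatewise in `{i+j+l = 2}`, all with `m₁` positions of letter `(1,1,0)`,
`m₂` of `(0,1,1)`, `m₃` of `(1,0,1)`, `m₄` of `(0,2,0)`, `m₅` of `(2,0,0)`, forming a free diagonal,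
`TW_b^{⊗N}` restricts to `⟨|Δ|⟩ ⊗ ⟨b^{m₁}, (2b)^{m₂} 2^{m₁} 2^{m₄}, (2b)^{m₃} 2^{m₅}⟩`
(letters `(1,1,0) ↦ ⟨b,2,1⟩` via `xᵢ ↦ x′ᵢ + x″ᵢ`, `(0,1,1) ↦ ⟨1,2b,1⟩`, `(1,0,1) ↦ ⟨1,1,2b⟩`,
`(0,2,0) ↦ ⟨1,2,1⟩`, `(2,0,0) ↦ ⟨1,1,2⟩`, `(0,0,2) ↦ ⟨1,1,1⟩`; BCS Prop. 15.30 in the linear form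
`tensorRestrictsTo_kroneckerPow_matMulDirectSum_of_free_linear`).  This is the twin analogue of the
tree's `stub_cwRectRestriction`. [cite: BurgisserClausenShokrollahi1997, Prop. 15.30 and Thm. 15.41 (proof, p. 381)] -/
theorem twRectRestriction (b m₁ m₂ m₃ m₄ m₅ N : ℕ)
    (Δ : Finset ((Fin N → Fin 3) × (Fin N → Fin 3) × (Fin N → Fin 3)))
    (hS : ∀ δ ∈ Δ, ∀ ρ, labelSeq δ ρ ∈ cwSupport₃)
    (hcnt : ∀ δ ∈ Δ, letterCount (labelSeq δ) (1, 1, 0) = m₁ ∧ letterCount (labelSeq δ) (0, 1, 1) = m₂ ∧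
      letterCount (labelSeq δ) (1, 0, 1) = m₃ ∧ letterCount (labelSeq δ) (0, 2, 0) = m₄ ∧
      letterCount (labelSeq δ) (2, 0, 0) = m₅)
    (hfree : ∀ δ ∈ Δ, ∀ δ' ∈ Δ, ∀ δ'' ∈ Δ, (∀ ρ, (δ.1 ρ, δ'.2.1 ρ, δ''.2.2 ρ) ∈ cwSupport₃) →
      δ = δ' ∧ δ' = δ'') :
    TensorRestrictsTo (kroneckerPow (twTensor ℂ b) N)
      (kroneckerTensor (unitTensor ℂ Δ.card)
        (matMulTensor ℂ (b ^ m₁) ((b + b) ^ m₂ * 2 ^ m₁ * 2 ^ m₄) ((b + b) ^ m₃ * 2 ^ m₅))) := by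
  classical
  -- enumerate `Δ` injectively
  set p := Δ.card with hp
  set d : Fin p → (Fin N → Fin 3) × (Fin N → Fin 3) × (Fin N → Fin 3) :=
    fun i => (Δ.equivFin.symm i).1 with hd_def
  have hdmem : ∀ i, d i ∈ Δ := fun i => (Δ.equivFin.symm i).2
  have hd : Function.Injective d := fun i i' h =>
    Δ.equivFin.symm.injective (Subtype.ext h)
  -- BCS Prop. 15.30, linear form, for `TW_b` with its component matrices
  have hres := tensorRestrictsTo_kroneckerPow_matMulDirectSum_of_free_linear (twTensor ℂ b)
    (levX b) (levX b) (levZ b) cwSupport₃ (fun _ _ _ h => twTensor_mem_support h)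
    (twFmtK b) (twFmtM b) (twFmtN b) (twMI ℂ b) (twMJ ℂ b) (twML ℂ b)
    (fun s hs u a h => levX_of_twMI_ne_zero s hs u a h)
    (fun s hs v c h => levX_of_twMJ_ne_zero s hs v c h)
    (fun s hs w c h => levZ_of_twML_ne_zero s hs w c h)
    (fun s hs u v w => twTensor_component s hs u v w)
    d (fun i ρ => hS _ (hdmem i) ρ)
    (fun i i' i'' h => by
      have h' := hfree _ (hdmem i) _ (hdmem i') _ (hdmem i'') h
      exact ⟨hd h'.1, hd h'.2⟩)
  -- the block formats are constant on `Δ`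
  have hK : ∀ i, ∏ ρ, twFmtK b (labelSeq (d i) ρ) = b ^ m₁ := fun i => by
    rw [prod_twFmtK_eq (labelSeq (d i)), (hcnt _ (hdmem i)).1]
  have hM : ∀ i, ∏ ρ, twFmtM b (labelSeq (d i) ρ) = (b + b) ^ m₂ * 2 ^ m₁ * 2 ^ m₄ := fun i => by
    rw [prod_twFmtM_eq (labelSeq (d i)), (hcnt _ (hdmem i)).1, (hcnt _ (hdmem i)).2.1,
      (hcnt _ (hdmem i)).2.2.2.1]
  have hN : ∀ i, ∏ ρ, twFmtN b (labelSeq (d i) ρ) = (b + b) ^ m₃ * 2 ^ m₅ := fun i => by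
    rw [prod_twFmtN_eq (labelSeq (d i)), (hcnt _ (hdmem i)).2.2.1, (hcnt _ (hdmem i)).2.2.2.2]
  exact hres.trans (tensorRestrictsTo_matMulDirectSum_multiple_of_eq _ _ _ hK hM hN)

end TwinData

/-! ### From a free diagonal to an exponent inequality (`b = 2^j`) -/

section Chain

open Literature.Barriers.MatrixMultiplication
  (asymptoticRank_le_of_polyDegeneratesTo asymptoticRank_kroneckerPow_le)
open Summit.MatrixMultiplication.MatrixMultiplication.Theorems.SaturationLadderTwinCW
  (twTensor asymptoticRank_twTensor_le)

/-- `(2^j + 2^j)^m · 2^a · 2^c = 2^{(j+1) m + a + c}`. [folklore] -/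
theorem two_pow_formats (j m a c : ℕ) :
    (2 ^ j + 2 ^ j) ^ m * 2 ^ a * 2 ^ c = 2 ^ ((j + 1) * m + a + c) := by
  have h2 : 2 ^ j + 2 ^ j = 2 ^ (j + 1) := by rw [pow_succ]; ring
  rw [h2, ← pow_mul, ← pow_add, ← pow_add]

/-- **The exponent inequality of the twin laser method** (`b = 2^j`): a free diagonal `Δ` of
`cwSupport₃^N`-supported level triples with letter counts `(m₁, …, m₅)` gives
`|Δ| · 2^{ω(j m₁, (j+1) m₂ + m₁ + m₄, (j+1) m₃ + m₅)} ≤ R̃(⟨|Δ|⟩ ⊗ ⟨2^{j m₁}, 2^{(j+1)m₂+m₁+m₄}, 2^{(j+1)m₃+m₅}⟩)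
≤ R̃(TW_b^{⊗N}) ≤ (2b + 3)^N = (2^{j+1} + 3)^N`.
[cite: AlmanDuanVassilevskaWilliamsXuXuZhou2025, Thm. 3.2] [cite: ChristandlVranaZuiddam2023, §1.1] -/
theorem twChain (j m₁ m₂ m₃ m₄ m₅ N : ℕ) (hN : 0 < N)
    (Δ : Finset ((Fin N → Fin 3) × (Fin N → Fin 3) × (Fin N → Fin 3)))
    (hS : ∀ δ ∈ Δ, ∀ ρ, labelSeq δ ρ ∈ cwSupport₃)
    (hcnt : ∀ δ ∈ Δ, letterCount (labelSeq δ) (1, 1, 0) = m₁ ∧ letterCount (labelSeq δ) (0, 1, 1) = m₂ ∧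
      letterCount (labelSeq δ) (1, 0, 1) = m₃ ∧ letterCount (labelSeq δ) (0, 2, 0) = m₄ ∧
      letterCount (labelSeq δ) (2, 0, 0) = m₅)
    (hfree : ∀ δ ∈ Δ, ∀ δ' ∈ Δ, ∀ δ'' ∈ Δ, (∀ ρ, (δ.1 ρ, δ'.2.1 ρ, δ''.2.2 ρ) ∈ cwSupport₃) →
      δ = δ' ∧ δ' = δ'')
    (hV : 1 ≤ Δ.card) :
    (Δ.card : ℝ) * (2 : ℝ) ^ omegaRect ℂ ((j : ℝ) * m₁) (((j : ℝ) + 1) * m₂ + m₁ + m₄)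
        (((j : ℝ) + 1) * m₃ + m₅) ≤ ((2 : ℝ) ^ (j + 1) + 3) ^ N := by
  have hres := twRectRestriction (2 ^ j) m₁ m₂ m₃ m₄ m₅ N Δ hS hcnt hfree
  have hK : (2 ^ j) ^ m₁ = 2 ^ (j * m₁) := (pow_mul 2 j m₁).symm
  have hM : (2 ^ j + 2 ^ j) ^ m₂ * 2 ^ m₁ * 2 ^ m₄ = 2 ^ ((j + 1) * m₂ + m₁ + m₄) :=
    two_pow_formats j m₂ m₁ m₄
  have hN' : (2 ^ j + 2 ^ j) ^ m₃ * 2 ^ m₅ = 2 ^ ((j + 1) * m₃ + m₅) := by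
    simpa using two_pow_formats j m₃ 0 m₅
  rw [hK, hM, hN'] at hres
  -- the asymptotic sum inequality at base `2`
  have hasi := advxxz2025_thm32 ℂ (le_refl 2) (j * m₁) ((j + 1) * m₂ + m₁ + m₄)
    ((j + 1) * m₃ + m₅) hV
  have h2 := asymptoticRank_le_of_polyDegeneratesTo hres.polyDegeneratesTo
  have htw : asymptoticRank (twTensor ℂ (2 ^ j)) ≤ (2 : ℝ) ^ (j + 1) + 3 := by
    have h := asymptoticRank_twTensor_le ℂ (2 ^ j)
    have e : ((2 ^ j : ℕ) : ℝ) + ((2 ^ j : ℕ) : ℝ) + 3 = (2 : ℝ) ^ (j + 1) + 3 := by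
      push_cast; ring
    rw [← e]; exact h
  have h3 : asymptoticRank (kroneckerPow (twTensor ℂ (2 ^ j)) N) ≤ ((2 : ℝ) ^ (j + 1) + 3) ^ N :=
    (asymptoticRank_kroneckerPow_le (twTensor ℂ (2 ^ j)) hN).trans
      (pow_le_pow_left₀ (asymptoticRank_nonneg _) htw N)
  push_cast at hasi
  exact hasi.trans (h2.trans h3)

/-- **Solved form**: a free diagonal as in `twChain` with `(2^{j+1} + 3)^N ≤ |Δ| · 2^e` certifies
`ω(j m₁, (j+1) m₂ + m₁ + m₄, (j+1) m₃ + m₅) ≤ e` — the conversion into which the packing count of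
the twin-optimal joint types is to be plugged. [cite: AlmanDuanVassilevskaWilliamsXuXuZhou2025, Thm. 3.2] -/
theorem omegaRect_tw_le_of_card (j m₁ m₂ m₃ m₄ m₅ N : ℕ) (hN : 0 < N)
    (Δ : Finset ((Fin N → Fin 3) × (Fin N → Fin 3) × (Fin N → Fin 3)))
    (hS : ∀ δ ∈ Δ, ∀ ρ, labelSeq δ ρ ∈ cwSupport₃)
    (hcnt : ∀ δ ∈ Δ, letterCount (labelSeq δ) (1, 1, 0) = m₁ ∧ letterCount (labelSeq δ) (0, 1, 1) = m₂ ∧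
      letterCount (labelSeq δ) (1, 0, 1) = m₃ ∧ letterCount (labelSeq δ) (0, 2, 0) = m₄ ∧
      letterCount (labelSeq δ) (2, 0, 0) = m₅)
    (hfree : ∀ δ ∈ Δ, ∀ δ' ∈ Δ, ∀ δ'' ∈ Δ, (∀ ρ, (δ.1 ρ, δ'.2.1 ρ, δ''.2.2 ρ) ∈ cwSupport₃) →
      δ = δ' ∧ δ' = δ'')
    (hV : 1 ≤ Δ.card) (e : ℝ) (hcard : ((2 : ℝ) ^ (j + 1) + 3) ^ N ≤ (Δ.card : ℝ) * (2 : ℝ) ^ e) :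
    omegaRect ℂ ((j : ℝ) * m₁) (((j : ℝ) + 1) * m₂ + m₁ + m₄) (((j : ℝ) + 1) * m₃ + m₅) ≤ e := by
  have h := (twChain j m₁ m₂ m₃ m₄ m₅ N hN Δ hS hcnt hfree hV).trans hcard
  have hV0 : (0 : ℝ) < Δ.card := by exact_mod_cast hV
  exact (Real.rpow_le_rpow_left_iff (by norm_num : (1 : ℝ) < 2)).1 (le_of_mul_le_mul_left h hV0)

end Chain

end Summit.MatrixMultiplication.MatrixMultiplication.Theorems.SaturationLadderTwinRestriction
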